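import Summits.BirchSwinnertonDyer.BirchSwinnertonDyer.Theorems.AlignedTransportAtTwoMainConjectureOfRankZeroBSDAtTwoTwinValueHensel
import HarnessLib

/-!
# Route `AlignedTransportAtTwo`, crux C2 `MainConjectureOfRankZeroBSDAtTwo` (stmt-BirchSwinnertonDyer-22298):
# THE TWIN-VALUE DOOR PINS `λ = 2` EXACTLY — Weierstrass preparation + Hensel's lemma kill the last shape
# (a single `ι`-fixed prime of degree `≥ 4`), so `{ord₂ F(0), ord₂ F(−2)} ∋ 2` with the two distinct ⟹ `μ(F) = 0 ∧ λ(F) = 2`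

HONEST FRAMING (cell `bsd-f1-sign2`, WIDTH-5 attached prover seat `bsd-line-att-p5` gen 49 on line `birth` of the lead
`bsd-line-att-p2`; `--supports` stmt-BirchSwinnertonDyer-22298, closes nothing; BSD is NOT proved by any of this; the crux
C2, its verdict «blocked-on `Rank1Residual.GreenbergMuConjectureIrreducible`» and every registered stub are untouched).
THEOREMS ONLY — no `def`, no instance, no named fact, no `sorry`. PRINT binder `h114` = Greenberg Thm. 1.14 at the datum level;
Greenberg's Thm. 4.1 is the kernel theorem. Sequel of `…TwinValueAlgebra` / `…TwinValueDichotomy` / `…TwinValue` / `…TwinValueParity` / `…TwinValueHensel`.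

THE POINT. `…TwinValueParity.mu_eq_zero_and_even_lambda_of_twinValue` leaves `λ(X)` even `≥ 2`. The only `ι`-stable shape with
`{a, b} = {2, ≥ 3}` (`a = ord₂ F(0)`, `b = ord₂ F(−2)`) and `λ ≥ 4` is a single `ι`-fixed prime `π` of even degree `d ≥ 4`; for it the mod-`8`
residue `π(−2) ≡ π₀ − 2π₁ (mod 8)` (`π₂` even as `d > 2`) forces `ord₂ π₁ = 1` next to `ord₂ π₀ ≥ 2`, and then the Newton polygon of `π` has a
segment of slope `−1` of length ONE: a `ℤ₂`-rational root. Kernel version: Weierstrass-prepare `π = f·h` (Mathlib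
`PowerSeries.exists_isWeierstrassFactorization`, `f` distinguished of degree `d = λ(π)`), take `a = −f₀/f₁` (`ord₂ a ≥ 1`), check
`8 ∣ f(a)` and `f′(a) = 2·unit`, apply Mathlib's `hensels_lemma`: a root `z ∈ 2ℤ₂`, so `(T − z) ∣ π` with `λ(T − z) = 1 < 3 ≤ λ(π)` —
`π` is reducible.

* §1 is the sibling `…TwinValueHensel` (`not_irreducible_of_hensel`: `μ(π) = 0`, `3 ≤ λ(π)`, `4 ∣ π₀`, `4 ∤ π₁` ⟹ `π` reducible).
* §2 `evalAt_neg_two_eq_mod_eight` (`2 ∣ F₂ ⟹ F(−2) ≡ F₀ − 2F₁ (mod 8)`); ★★★ `lam_eq_two_of_twinValue` (algebra): `ι`-stable `F ≠ 0`, `F(0)F(−2) ≠ 0`,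
  `{a, b} ∋ 2`, `a ≠ b` ⟹ **`λ(F) = 2`** (and `μ(F) = 0`).
* §3 (datum) ★★★ `mu_eq_zero_and_lambda_eq_two_of_twinValue`: under the twin-value door's hypotheses **`μ(X(W/ℚ_∞)) = 0 ∧ λ(X(W/ℚ_∞)) = 2`**:
  the whole Iwasawa module of `W` along `ℚ_∞` is `ℤ₂²` up to finite index, its characteristic series an `ι`-mirror pair of zeros
  (of valuation `1` at weight `2`, of valuation `2` at twin value `2`) or one `ι`-fixed quadratic prime.

References: R. Greenberg, LNM 1716 (1999) Thm. 1.14, Thm. 4.1, §5 [GreenbergLNM1716]; L. Washington, GTM 83, Thm. 7.3 (Weierstrass preparation),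
§7.1 [Washington1997]; K. Conrad / Mathlib `hensels_lemma` (Hensel's lemma over `ℤ_p`) [folklore]; B. Mazur, J. Tate, J. Teitelbaum, Invent. Math.
84 (1986) Ch. I §17 [MazurTateTeitelbaum1986Invent].
-/

set_option linter.dupNamespace false
set_option autoImplicit false

noncomputable section

open scoped Classical

namespace Summit.BirchSwinnertonDyer.BirchSwinnertonDyer.Theorems.AlignedTransportAtTwoTwinValueLambda

open PowerSeries WeierstrassCurve Literature.NumberTheory.EllipticCurves Literature.NumberTheory.EllipticCurves.IwasawaAlgebra
  Literature.NumberTheory.EllipticCurves.Greenberg1999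
  Summit.BirchSwinnertonDyer.Rank1Residual.X1.MuLambda Summit.BirchSwinnertonDyer.Rank1Residual.X1.ParitySqueeze
  Summit.BirchSwinnertonDyer.Rank1Residual.Supersingular Summit.BirchSwinnertonDyer.Rank1Residual.Supersingular.BlindLever
  Summit.BirchSwinnertonDyer.BirchSwinnertonDyer.Theorems
  Summit.BirchSwinnertonDyer.BirchSwinnertonDyer.Theorems.AlignedTransportAtTwoTwinValueAlgebra
  Summit.BirchSwinnertonDyer.BirchSwinnertonDyer.Theorems.AlignedTransportAtTwoTwinValue
  Summit.BirchSwinnertonDyer.BirchSwinnertonDyer.Theorems.AlignedTransportAtTwoTwinValueParity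
  Summit.BirchSwinnertonDyer.BirchSwinnertonDyer.Theorems.AlignedTransportAtTwoTwistSaturation
  Summit.BirchSwinnertonDyer.BirchSwinnertonDyer.Theorems.AlignedTransportAtTwoCyclotomicLayerWeightEuler
  Summit.BirchSwinnertonDyer.BirchSwinnertonDyer.Theorems.TwoAdicEulerCharKernel

/-! ## §2 `λ = 2` in the twin-value door (algebra) -/

section Algebra

/-- **`F(−2) ≡ F₀ − 2F₁ (mod 8)` when `2 ∣ F₂`** (refines `…TwinValueAlgebra.evalAt_neg_two_eq`: the twice-shifted value is `≡ F₂ (mod 2)`).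
[cite: Washington1997, §7.1] -/
theorem evalAt_neg_two_eq_mod_eight {F : IwasawaAlgebra 2} (h2 : (2 : ℤ_[2]) ∣ coeff 2 F) :
    (8 : ℤ_[2]) ∣ evalAt (-2 : ℤ_[2]) F - (constantCoeff F - 2 * coeff 1 F) := by
  set F₁ : PowerSeries ℤ_[2] := PowerSeries.mk fun n ↦ coeff (n + 1) F with hF₁
  set F₂ : PowerSeries ℤ_[2] := PowerSeries.mk fun n ↦ coeff (n + 1) F₁ with hF₂
  have e1 : F = PowerSeries.X * F₁ + PowerSeries.C (constantCoeff F) := eq_X_mul_shift_add_const F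
  have e2 : F₁ = PowerSeries.X * F₂ + PowerSeries.C (constantCoeff F₁) := eq_X_mul_shift_add_const F₁
  have hc1 : constantCoeff F₁ = coeff 1 F := by rw [hF₁, ← coeff_zero_eq_constantCoeff_apply, coeff_mk]
  have hc2 : constantCoeff F₂ = coeff 2 F := by
    rw [hF₂, ← coeff_zero_eq_constantCoeff_apply, coeff_mk, hF₁, coeff_mk]
  have ev1 := congrArg (evalAtHom norm_neg_two_lt_one) e1
  have ev2 := congrArg (evalAtHom norm_neg_two_lt_one) e2
  simp only [map_add, map_mul, evalAtHom_apply, evalAt_X, evalAt_C] at ev1 ev2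
  -- `evalAt F₂ ≡ F₂(0) = coeff 2 F (mod 2)`
  have hF2 : (2 : ℤ_[2]) ∣ evalAt (-2 : ℤ_[2]) F₂ := by
    have hlt := norm_evalAt_sub_constantCoeff_lt_one norm_neg_two_lt_one F₂
    have hd : ((2 : ℕ) : ℤ_[2]) ∣ evalAt (-2 : ℤ_[2]) F₂ - constantCoeff F₂ := (PadicInt.norm_lt_one_iff_dvd _).mp hlt
    rw [Nat.cast_ofNat, hc2] at hd
    have := dvd_add hd h2
    rwa [sub_add_cancel] at this
  obtain ⟨c, hc⟩ := hF2
  refine ⟨c, ?_⟩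
  rw [ev1, ev2, hc1, hc]
  ring

/-- `4 ∤ F₁` from the two residues: if `F(−2) ≡ F₀ − 2F₁ (mod 8)`, `8 ∤ F₀` and `8 ∣ F(−2)` then `4 ∤ F₁`. [cite: Washington1997, §7.1] -/
theorem two_dvd_not_four_dvd_of_residues {x₀ x₁ e : ℤ_[2]} (h8 : (8 : ℤ_[2]) ∣ e - (x₀ - 2 * x₁))
    (hx₀' : ¬ (8 : ℤ_[2]) ∣ x₀) (he : (8 : ℤ_[2]) ∣ e) : ¬ (4 : ℤ_[2]) ∣ x₁ := by
  intro h4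
  apply hx₀'
  -- `x₀ = e − (e − (x₀ − 2x₁)) − 2x₁`... : `8 ∣ e`, `8 ∣ e − (x₀ − 2x₁)`, `8 ∣ 2x₁`
  have h2x : (8 : ℤ_[2]) ∣ 2 * x₁ := by
    obtain ⟨y, hy⟩ := h4; exact ⟨y, by rw [hy]; ring⟩
  have := dvd_add (dvd_sub he h8) h2x
  have e' : e - (e - (x₀ - 2 * x₁)) + 2 * x₁ = x₀ := by ring
  rw [e'] at this
  exact this

/-- The mirror bookkeeping: `8 ∣ x₀`, `8 ∤ e`, `8 ∣ e − (x₀ − 2x₁)` ⟹ `4 ∤ x₁`. [cite: Washington1997, §7.1] -/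
theorem two_dvd_not_four_dvd_of_residues' {x₀ x₁ e : ℤ_[2]} (h8 : (8 : ℤ_[2]) ∣ e - (x₀ - 2 * x₁))
    (hx₀ : (8 : ℤ_[2]) ∣ x₀) (he' : ¬ (8 : ℤ_[2]) ∣ e) : ¬ (4 : ℤ_[2]) ∣ x₁ := by
  intro h4
  apply he'
  have h2x : (8 : ℤ_[2]) ∣ 2 * x₁ := by
    obtain ⟨y, hy⟩ := h4; exact ⟨y, by rw [hy]; ring⟩
  have := dvd_sub (dvd_add h8 hx₀) h2x
  have e' : e - (x₀ - 2 * x₁) + x₀ - 2 * x₁ = e := by ring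
  rw [e'] at this
  exact this

/-- ★★★ **`λ = 2` IN THE TWIN-VALUE DOOR (algebra).** For non-zero `F ∈ ℤ₂⟦T⟧` with `ι`-stable ideal, `F(0) ≠ 0`, `F(−2) ≠ 0`, if ONE of
`a = ord₂ F(0)`, `b = ord₂ F(−2)` equals `2` and the other does not, then **`μ(F) = 0` and `λ(F) = 2`**. (The dichotomy gives `μ = 0`; an
irreducible `π ∣ F`: if `ι`-moved, `F ~ π·ιπ·unit` with `λ(π) = 1`; if `ι`-fixed with both values `≥ 2`, `F ~ π` and `λ(π) ∈ {2} ∪ [4, ∞)`, the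
latter killed by §1; if `ι`-fixed with both values `1`, the cofactor would violate the dichotomy.) [cite: GreenbergLNM1716, Thm. 1.14]
[cite: Washington1997, Thm. 7.3 and §7.1] [cite: MazurTateTeitelbaum1986Invent, Ch. I §17] -/
theorem lam_eq_two_of_twinValue {F : IwasawaAlgebra 2} (hF0 : F ≠ 0) (hι : ∃ u : (IwasawaAlgebra 2)ˣ, invol 2 F = u * F)
    (h0 : constantCoeff F ≠ 0) (h2 : evalAt (-2 : ℤ_[2]) F ≠ 0)
    (hmin : (constantCoeff F).valuation = 2 ∨ (evalAt (-2 : ℤ_[2]) F).valuation = 2)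
    (hne : (constantCoeff F).valuation ≠ (evalAt (-2 : ℤ_[2]) F).valuation) : mu F = 0 ∧ lam F = 2 := by
  have hμ : mu F = 0 := mu_eq_zero_of_two_eq_of_ne hF0 hι h0 h2 hmin hne
  obtain ⟨haF, hbF⟩ := mu_add_two_le_of_ne hF0 hι h0 h2 hne
  rw [hμ, zero_add] at haF hbF
  refine ⟨hμ, ?_⟩
  -- `F` is not a unit (one of its two values has order `2`)
  have hFu : ¬ IsUnit F := by
    intro hu
    rcases hmin with h | h
    · have := valuation_eq_zero_of_isUnit (isUnit_iff_constantCoeff.mp hu); omega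
    · have := valuation_eq_zero_of_isUnit ((isUnit_evalAt_iff norm_neg_two_lt_one F).mpr hu); omega
  obtain ⟨π, hπirr, hπF⟩ := WfDvdMonoid.exists_irreducible_factor hFu hF0
  have hπ : Prime π := hπirr.prime
  have hπ0 : π ≠ 0 := hπ.ne_zero
  obtain ⟨G, hFG⟩ := hπF
  have hG0 : G ≠ 0 := fun h ↦ hF0 (by rw [hFG, h, mul_zero])
  have hcc : constantCoeff F = constantCoeff π * constantCoeff G := by rw [hFG, map_mul]
  have hev : evalAt (-2 : ℤ_[2]) F = evalAt (-2 : ℤ_[2]) π * evalAt (-2 : ℤ_[2]) G := by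
    rw [hFG, evalAt_mul norm_neg_two_lt_one]
  have hπc0 : constantCoeff π ≠ 0 := fun h ↦ h0 (by rw [hcc, h, zero_mul])
  have hGc0 : constantCoeff G ≠ 0 := fun h ↦ h0 (by rw [hcc, h, mul_zero])
  have hπe0 : evalAt (-2 : ℤ_[2]) π ≠ 0 := fun h ↦ h2 (by rw [hev, h, zero_mul])
  have hGe0 : evalAt (-2 : ℤ_[2]) G ≠ 0 := fun h ↦ h2 (by rw [hev, h, mul_zero])
  have haF' : (constantCoeff F).valuation = (constantCoeff π).valuation + (constantCoeff G).valuation := by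
    rw [hcc, PadicInt.valuation_mul hπc0 hGc0]
  have hbF' : (evalAt (-2 : ℤ_[2]) F).valuation = (evalAt (-2 : ℤ_[2]) π).valuation + (evalAt (-2 : ℤ_[2]) G).valuation := by
    rw [hev, PadicInt.valuation_mul hπe0 hGe0]
  have haπ : 1 ≤ (constantCoeff π).valuation := one_le_valuation_constantCoeff_of_not_isUnit hπirr.not_isUnit hπc0
  have hbπ : 1 ≤ (evalAt (-2 : ℤ_[2]) π).valuation := one_le_valuation_evalAt_of_not_isUnit hπirr.not_isUnit hπe0
  have hlamF : lam F = lam π + lam G := by rw [hFG, lam_mul hπ0 hG0]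
  have hμF : mu F = mu π + mu G := by rw [hFG, mu_mul hπ0 hG0]
  have hμπ : mu π = 0 := by omega
  have hμG : mu G = 0 := by omega
  -- `π ∤ T`, `π ∤ T + 2`
  have hπX : ¬ π ∣ PowerSeries.X := by
    intro h
    have hassoc : Associated π (PowerSeries.X : IwasawaAlgebra 2) := hπirr.associated_of_dvd X_prime.irreducible h
    exact h0 (X_dvd_iff.mp (hassoc.symm.dvd.trans ⟨G, hFG⟩))
  have hπX2 : ¬ π ∣ (PowerSeries.X + PowerSeries.C (2 : ℤ_[2])) := by
    intro h
    have hassoc : Associated π (PowerSeries.X + PowerSeries.C (2 : ℤ_[2]) : IwasawaAlgebra 2) :=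
      hπirr.associated_of_dvd prime_X_add_C_two.irreducible h
    obtain ⟨H, hH⟩ := hassoc.symm.dvd.trans ⟨G, hFG⟩
    apply h2
    rw [hH, evalAt_mul norm_neg_two_lt_one, evalAt_neg_two_X_add_C_two, zero_mul]
  -- `λ(π) ≠ 0`
  have hlamπ0 : lam π ≠ 0 := fun h ↦ hπirr.not_isUnit ((isUnit_iff_mu_eq_zero_and_lam_eq_zero π).mpr ⟨hπ0, hμπ, h⟩)
  -- units have both values of order `0`; helper to read `G` unit off a vanishing order
  have unit_of_val0 : ∀ {H : IwasawaAlgebra 2}, constantCoeff H ≠ 0 → (constantCoeff H).valuation = 0 → IsUnit H := by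
    intro H hH0 hv
    by_contra hnu
    have := one_le_valuation_constantCoeff_of_not_isUnit hnu hH0
    omega
  have unit_of_val0' : ∀ {H : IwasawaAlgebra 2}, evalAt (-2 : ℤ_[2]) H ≠ 0 → (evalAt (-2 : ℤ_[2]) H).valuation = 0 → IsUnit H := by
    intro H hH0 hv
    by_contra hnu
    have := one_le_valuation_evalAt_of_not_isUnit hnu hH0
    omega
  by_cases hfix : Associated (invol 2 π) π
  · -- `ι`-fixed prime
    have h4 := four_dvd_of_fixed_prime hπ hμπ hfix hπX hπX2
    have hiff := two_le_valuation_iff_of_four_dvd_sub hπe0 hπc0 h4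
    have heven := even_lam_of_fixed_prime hπ hfix hπX hπX2
    have hιG : ∃ u : (IwasawaAlgebra 2)ˣ, invol 2 G = u * G := by
      obtain ⟨w, hw⟩ := hfix
      refine iotaStable_of_mul_left hι hFG hπ0 ⟨w⁻¹, ?_⟩
      rw [(Units.eq_mul_inv_iff_mul_eq w).mpr hw, mul_comm]
    by_cases ha1 : (constantCoeff π).valuation = 1
    · -- both values `1`: the cofactor has `{a, b} = {1, ≥ 2}`, impossible by the dichotomy for `G`
      have hb1 : (evalAt (-2 : ℤ_[2]) π).valuation = 1 := by
        by_contra hb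
        have := hiff.mp (by omega)
        omega
      exfalso
      have hneG : (constantCoeff G).valuation ≠ (evalAt (-2 : ℤ_[2]) G).valuation := by omega
      obtain ⟨h1, h2'⟩ := mu_add_two_le_of_ne hG0 hιG hGc0 hGe0 hneG
      rcases hmin with h | h <;> omega
    · -- both values `≥ 2`: `G` is a unit and `F ~ π`
      have ha2 : 2 ≤ (constantCoeff π).valuation := by omega
      have hb2 : 2 ≤ (evalAt (-2 : ℤ_[2]) π).valuation := hiff.mpr ha2
      have hGu : IsUnit G := by
        rcases hmin with h | h
        · exact unit_of_val0 hGc0 (by omega)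
        · exact unit_of_val0' hGe0 (by omega)
      have hlamG : lam G = 0 := lam_eq_zero_of_isUnit hGu
      rw [hlamF, hlamG, add_zero]
      -- `λ(π)` is even, nonzero; exclude `≥ 4` by Hensel
      by_contra hne2
      have hd4 : 4 ≤ lam π := by obtain ⟨k, hk⟩ := heven; omega
      have haG0 : (constantCoeff G).valuation = 0 := valuation_eq_zero_of_isUnit (isUnit_iff_constantCoeff.mp hGu)
      have hbG0 : (evalAt (-2 : ℤ_[2]) G).valuation = 0 :=
        valuation_eq_zero_of_isUnit ((isUnit_evalAt_iff norm_neg_two_lt_one G).mpr hGu)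
      -- residues of `π` modulo `8`
      have hπ2 : (2 : ℤ_[2]) ∣ coeff 2 π := by
        have := dvd_coeff_of_lt_lam hπ0 hμπ (k := 2) (by omega); rwa [Nat.cast_ofNat] at this
      have h8 := evalAt_neg_two_eq_mod_eight hπ2
      have hfour : (4 : ℤ_[2]) = 2 ^ 2 := by norm_num
      have height : (8 : ℤ_[2]) = 2 ^ 3 := by norm_num
      have hπ0dvd : (4 : ℤ_[2]) ∣ constantCoeff π := by rw [hfour, two_pow_dvd_iff_le_valuation hπc0]; exact ha2
      have hπ1' : ¬ (4 : ℤ_[2]) ∣ coeff 1 π := by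
        rcases hmin with ha | hb
        · -- `a(F) = 2`: `a(π) = 2`, `b(π) ≥ 3`
          have haπ2 : (constantCoeff π).valuation = 2 := by omega
          have hbπ3 : 3 ≤ (evalAt (-2 : ℤ_[2]) π).valuation := by omega
          refine two_dvd_not_four_dvd_of_residues h8 ?_ ?_
          · rw [height, two_pow_dvd_iff_le_valuation hπc0]; omega
          · rw [height, two_pow_dvd_iff_le_valuation hπe0]; exact hbπ3
        · -- `b(F) = 2`: `b(π) = 2`, `a(π) ≥ 3`
          have hbπ2 : (evalAt (-2 : ℤ_[2]) π).valuation = 2 := by omega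
          have haπ3 : 3 ≤ (constantCoeff π).valuation := by omega
          refine two_dvd_not_four_dvd_of_residues' h8 ?_ ?_
          · rw [height, two_pow_dvd_iff_le_valuation hπc0]; exact haπ3
          · rw [height, two_pow_dvd_iff_le_valuation hπe0]; omega
      exact not_irreducible_of_hensel hπ0 hμπ (by omega) hπ0dvd hπ1' hπirr
  · -- `ι`-moved prime: `F = π·ιπ·H`
    have hιπ : Prime (invol 2 π) := prime_invol hπ
    have hιπF : invol 2 π ∣ F := invol_dvd_of_dvd hι ⟨G, hFG⟩
    have hιπG : invol 2 π ∣ G := by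
      rw [hFG] at hιπF
      rcases hιπ.dvd_or_dvd hιπF with h | h
      · exact absurd (hιπ.irreducible.associated_of_dvd hπirr h) hfix
      · exact h
    obtain ⟨H, hGH⟩ := hιπG
    have hH0 : H ≠ 0 := fun h ↦ hG0 (by rw [hGH, h, mul_zero])
    have hιπ0 : invol 2 π ≠ 0 := hιπ.ne_zero
    have hccG : constantCoeff G = constantCoeff π * constantCoeff H := by rw [hGH, map_mul, constantCoeff_invol 2 π]
    have hevG : evalAt (-2 : ℤ_[2]) G = evalAt (-2 : ℤ_[2]) π * evalAt (-2 : ℤ_[2]) H := by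
      rw [hGH, evalAt_mul norm_neg_two_lt_one, evalAt_neg_two_invol]
    have hHc0 : constantCoeff H ≠ 0 := fun h ↦ hGc0 (by rw [hccG, h, mul_zero])
    have hHe0 : evalAt (-2 : ℤ_[2]) H ≠ 0 := fun h ↦ hGe0 (by rw [hevG, h, mul_zero])
    have haG : (constantCoeff G).valuation = (constantCoeff π).valuation + (constantCoeff H).valuation := by
      rw [hccG, PadicInt.valuation_mul hπc0 hHc0]
    have hbG : (evalAt (-2 : ℤ_[2]) G).valuation = (evalAt (-2 : ℤ_[2]) π).valuation + (evalAt (-2 : ℤ_[2]) H).valuation := by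
      rw [hevG, PadicInt.valuation_mul hπe0 hHe0]
    have hlamG : lam G = lam π + lam H := by rw [hGH, lam_mul hιπ0 hH0, lam_invol hπ0]
    -- which side is `2`?
    rcases hmin with ha | hb
    · -- `a(F) = 2 ⟹ a(π) = 1`, `H` unit, `b(π) ≥ 2`; then `λ(π) = 1`
      have haπ1 : (constantCoeff π).valuation = 1 := by omega
      have hHu : IsUnit H := unit_of_val0 hHc0 (by omega)
      have hbH0 : (evalAt (-2 : ℤ_[2]) H).valuation = 0 :=
        valuation_eq_zero_of_isUnit ((isUnit_evalAt_iff norm_neg_two_lt_one H).mpr hHu)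
      have hbπ2 : 2 ≤ (evalAt (-2 : ℤ_[2]) π).valuation := by omega
      have hlamπ : lam π = 1 := by
        by_contra hne1
        have h2le : 2 ≤ lam π := by omega
        have hπ1 : (2 : ℤ_[2]) ∣ coeff 1 π := by
          have := dvd_coeff_of_lt_lam hπ0 hμπ (k := 1) (by omega); rwa [Nat.cast_ofNat] at this
        have h4 := four_dvd_evalAt_sub_constantCoeff hπ1
        have hiff := two_le_valuation_iff_of_four_dvd_sub hπe0 hπc0 h4
        have := hiff.mp hbπ2
        omega
      rw [hlamF, hlamG, hlamπ, lam_eq_zero_of_isUnit hHu]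
    · -- `b(F) = 2 ⟹ b(π) = 1`, `H` unit, `a(π) ≥ 2`; then `λ(π) = 1`
      have hbπ1 : (evalAt (-2 : ℤ_[2]) π).valuation = 1 := by omega
      have hHu : IsUnit H := unit_of_val0' hHe0 (by omega)
      have haH0 : (constantCoeff H).valuation = 0 := valuation_eq_zero_of_isUnit (isUnit_iff_constantCoeff.mp hHu)
      have haπ2 : 2 ≤ (constantCoeff π).valuation := by omega
      have hlamπ : lam π = 1 := by
        by_contra hne1
        have h2le : 2 ≤ lam π := by omega
        have hπ1 : (2 : ℤ_[2]) ∣ coeff 1 π := by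
          have := dvd_coeff_of_lt_lam hπ0 hμπ (k := 1) (by omega); rwa [Nat.cast_ofNat] at this
        have h4 := four_dvd_evalAt_sub_constantCoeff hπ1
        have hiff := two_le_valuation_iff_of_four_dvd_sub hπe0 hπc0 h4
        have := hiff.mpr haπ2
        omega
      rw [hlamF, hlamG, hlamπ, lam_eq_zero_of_isUnit hHu]

end Algebra

/-! ## §3 Datum level: `μ = 0 ∧ λ = 2` -/

section Datum

variable (κ : ZpExtension ℚ 2) (hκ : κ.IsCyclotomic) {γ : Field.absoluteGaloisGroup ℚ} (hγ : κ.IsTopGenerator γ)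
  (hγ' : IsCyclotomicVariable 2 γ) (W : WeierstrassCurve ℚ) [W.IsElliptic] [W.IsGloballyMinimal]

include hκ hγ hγ' in
/-- ★★★ **THE TWIN-VALUE DOOR, SHARP: `μ(X(W/ℚ_∞)) = 0` AND `λ(X(W/ℚ_∞)) = 2`.** `W/ℚ` globally minimal, good ordinary at `2`,
`Sel_{2^∞}(W/ℚ)` finite, `(κ, γ)` the normalised cyclotomic datum, `D` any dual datum, `f_X` a generator of `char_Λ X` with `f_X(−2) ≠ 0`; data
`t, e, s` (`#W(ℚ)[2^∞] = 2^t`, `#Ẽ(𝔽₂)[2^∞] = 2^e`, `#Sel_{2^∞}(W/ℚ) = 2^s`), Euler weight `w = ord₂ ∏c_ℓ + 2e + s − 2t`; PRINT `h114`. If `{w, ord₂ f_X(−2)} ∋ 2`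
and `w ≠ ord₂ f_X(−2)`, then **`μ(X) = 0` and `λ(X) = 2`**: `X(W/ℚ_∞)` has `ℤ₂`-rank exactly `2`. [cite: GreenbergLNM1716, Thm. 1.14 (p. 68), Thm. 4.1 (p. 102)]
[cite: Washington1997, Thm. 7.3 and §13.2] [cite: MazurTateTeitelbaum1986Invent, Ch. I §17] -/
theorem mu_eq_zero_and_lambda_eq_two_of_twinValue (h114 : Greenberg1999_thm114_charIdeal_iota_invariant) (hord : IsOrdinaryAt W 2)
    (D : W.SelmerDualData κ γ) (hfin : Finite (W.selmerGroupPInfty 2)) {t e s : ℕ}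
    (ht : Nat.card (AddCommGroup.primaryComponent W.toAffine.Point 2) = 2 ^ t)
    (he : Nat.card (AddCommGroup.primaryComponent ((integralModelInt W).map (Int.castRingHom (ZMod 2))).toAffine.Point 2) = 2 ^ e)
    (hs : Nat.card (W.selmerGroupPInfty 2) = 2 ^ s) {fX : IwasawaAlgebra 2} (hchar : D.charIdeal = Ideal.span {fX})
    (h2 : evalAt (-2 : ℤ_[2]) fX ≠ 0)
    (htwo : padicValNat 2 W.tamagawaProduct + 2 * e + s - 2 * t = 2 ∨ (evalAt (-2 : ℤ_[2]) fX).valuation = 2)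
    (hne : padicValNat 2 W.tamagawaProduct + 2 * e + s - 2 * t ≠ (evalAt (-2 : ℤ_[2]) fX).valuation) :
    D.mu = 0 ∧ D.lambda = 2 := by
  haveI : Module.Finite (IwasawaAlgebra 2) D.X := D.module_finite_holds hγ
  have hD : D.IsTorsion := isTorsion_of_finite κ hκ hγ W hord D hfin
  obtain ⟨-, hnorm⟩ := norm_constantCoeff_charGen_eq_of_thm41 W thm41_charValue_rankZero_anyPrime_holds
    ((isOrdinaryAt_iff W 2).mp hord).1 ((isOrdinaryAt_iff W 2).mp hord).2 hκ hγ hγ' D hD hchar hfin ht he hs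
  obtain ⟨hc0, hval⟩ := valuation_eq_of_norm_eq_two_inv_pow hnorm
  have hfXne : fX ≠ 0 := fun h0 ↦ hc0 (by rw [h0, map_zero])
  have hι := iotaStable_charGen_of_thm114 h114 W hord hκ hγ D hD hchar
  have htwo' : (constantCoeff fX).valuation = 2 ∨ (evalAt (-2 : ℤ_[2]) fX).valuation = 2 := by rw [hval]; exact htwo
  have hne' : (constantCoeff fX).valuation ≠ (evalAt (-2 : ℤ_[2]) fX).valuation := by rw [hval]; exact hne
  obtain ⟨hμ, hlam⟩ := lam_eq_two_of_twinValue hfXne hι hc0 h2 htwo' hne'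
  have hmufX : mu fX = D.mu := Summit.BirchSwinnertonDyer.Rank1Residual.X1.MuPart.mu_generator_eq_muInvariant D.X hD hfXne hchar
  have hlamfX : lam fX = D.lambda := lam_generator_eq_lambdaInvariant D.X hD hfXne hchar
  exact ⟨by rw [← hmufX, hμ], by rw [← hlamfX, hlam]⟩

end Datum

end Summit.BirchSwinnertonDyer.BirchSwinnertonDyer.Theorems.AlignedTransportAtTwoTwinValueLambda

end
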